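import Mathlib.Analysis.SpecialFunctions.Pow.Real
import Mathlib.Analysis.Calculus.Deriv.MeanValue
import Literature.NumberTheory.LFunctions.DeBruijnPhiLogConcave
import HarnessLib

/-!
# The tilted potential `W_s(u) = −s·log u − log Φ(u)` of the laws `ν_s ∝ u^s Φ(u) du`: convexity and the mode

Topic `Literature/NumberTheory/LFunctions`; sequel of `DeBruijnPhiLogConcave.lean` (Coffey–Csordas 2013,
Theorem 2.4: the Pólya–de Bruijn kernel `Φ = deBruijnPhi` is strictly log-concave, quantitatively
`−(log Φ)″(u) > 16πe^{4|u|}`). The Taylor coefficients of `ξ` at `1/2` are the moments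
`M_k = ∫₀^∞ u^k Φ(u) du = xiMoment k` (`XiMoments.lean`), so the Jensen-polynomial moment method
(Griffin–Ono–Rolen–Zagier 2019; tree files `XiMomentConcentration.lean`, `JensenXiMoment*.lean`) studies the
probability laws `ν_k(du) = u^kΦ(u)du/M_k` on `(0, ∞)`, i.e. the Gibbs laws `e^{−W_k}/M_k` of the TILTED POTENTIAL

  `W_s(u) := −s·log u − log Φ(u)`,  `W_s′(u) = −s/u + L(u)`,  `W_s″(u) = s/u² + V(u)`,

with `L := −Φ′/Φ` and `V := L′ = (Φ′² − ΦΦ″)/Φ² = −(log Φ)″`. This file is the analytic dictionary for these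
laws in the raw `g, g₁, g₂ : ℝ → ℝ` / `HasDerivAt` shape consumed by the tree's one-dimensional Brascamp–Lieb
inequality (`Literature.Probability.Distributions.brascampLieb_interval`) and by the supporting-line tail bounds
(`Literature/Probability/Distributions/ConvexPotentialTails.lean`):

* `phiNegLogDeriv` (`L`), `phiNegLogDeriv₂` (`V`): `L(0) = 0`, `L > 0` on `(0,∞)`, `L′ = V`, `V` continuous,
  `V(u) > 16πe^{4|u|}` (Coffey–Csordas Thm 2.4, quantitative form of the tree), `L` strictly increasing;
* `xiPotential s` (`W_s`), `xiPotentialDeriv s`, `xiPotentialDeriv₂ s`: `e^{−W_s(u)} = u^sΦ(u)` (`u > 0`), the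
  `HasDerivAt` chain on `u ≠ 0`, `W_s″(u) > s/u² + 16πe^{4u} > 0` (`s ≥ 0`), `W_s′` strictly increasing and `W_s`
  strictly convex on `(0, ∞)`, `W_s → +∞` at `0⁺` (`s > 0`) and at `+∞`;
* THE MODE `xiMode s = a_s` (`s > 0`): the unique zero of `W_s′` on `(0, ∞)` (`4.1 MODE BRACKET` of the ladder
  write-up): `W_s′(u) < 0 ⇔ u < a_s`, `W_s′(u) ≤ 0 ⇔ u ≤ a_s` (so any `u₀ > 0` with `W_s′(u₀) ≤ 0` is a certified
  lower bound `u₀ ≤ a_s`, and `W_s′(u₀) ≥ 0` an upper bound), the saddle equation `s = a_s·L(a_s)`, `W_s` minimal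
  at `a_s` and strictly monotone on either side, and `s ↦ a_s` strictly increasing.

The mode `a_s` is NOT the tree's `xiSaddle s = XiKernel.saddle s` (the critical point of the one-term model
`s log u + 9u − πe^{4u}`, `4πe^{4a} = s/a + 9`); relating the two quantitatively needs the envelope of `L`
(Lemma E of the ladder write-up) and is not done here. Nothing in this file concerns zeros of `ζ`.

## References

* M. W. Coffey, G. Csordas, *On the log-concavity of a Jacobi theta function*, Math. Comp. 82 (2013)
  2265–2272, Theorem 2.4 and §1 (log-concavity `⇔ (f′)² − ff″ ≥ 0`). [CoffeyCsordas2013]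
* M. Griffin, K. Ono, L. Rolen, D. Zagier, *Jensen polynomials for the Riemann zeta function and other
  sequences*, PNAS 116 (2019), §4–5 (the moments `∫ u^k Φ`, saddle point of `u^kΦ(u)`). [GORZPNAS2019]
* J. Peypouquet, *Convex Optimization in Normed Spaces* (2015), Prop. 3.10–3.11 (first-order characterisations
  of (strict) convexity; critical points of convex functions are global minimisers). [Peypouquet2015]
-/

noncomputable section

open Filter Set Topology
open scoped Real

namespace Literature.NumberTheory.LFunctions

/-! ## 1. `L = −Φ′/Φ` and `V = L′ = −(log Φ)″` -/

/-- `L(u) := −Φ′(u)/Φ(u)`, the negative logarithmic derivative of the Pólya–de Bruijn kernel (`= −(log Φ)′`).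
[cite: CoffeyCsordas2013, §1 (p. 2265)] -/
def phiNegLogDeriv (u : ℝ) : ℝ := -deBruijnPhiDeriv u / deBruijnPhi u

/-- `V(u) := (Φ′(u)² − Φ(u)Φ″(u))/Φ(u)²`, i.e. `V = L′ = −(log Φ)″` (the quantity `S(t)/Φ²` of Coffey–Csordas
(2.17)). [cite: CoffeyCsordas2013, Theorem 2.4 ((2.17))] -/
def phiNegLogDeriv₂ (u : ℝ) : ℝ :=
  (deBruijnPhiDeriv u ^ 2 - deBruijnPhi u * deBruijnPhiDeriv₂ u) / deBruijnPhi u ^ 2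

/-- `L(0) = 0` (`Φ′` is odd). [cite: CoffeyCsordas2013, §1 (p. 2265)] -/
theorem phiNegLogDeriv_zero : phiNegLogDeriv 0 = 0 := by
  have h := deBruijnPhiDeriv_neg 0
  rw [neg_zero] at h
  have h0 : deBruijnPhiDeriv 0 = 0 := by linarith
  simp [phiNegLogDeriv, h0]

/-- `L(u) > 0` for `u > 0` (`Φ > 0`, `Φ′ < 0` on `(0, ∞)`). [cite: CoffeyCsordas2013, §1 (p. 2265)] -/
theorem phiNegLogDeriv_pos {u : ℝ} (hu : 0 < u) : 0 < phiNegLogDeriv u :=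
  div_pos (neg_pos.2 (deBruijnPhiDeriv_neg_of_pos hu)) (deBruijnPhi_pos_holds u)

/-- `L(u) = −(log Φ)′(u)`. [cite: CoffeyCsordas2013, §1 (p. 2265)] -/
theorem phiNegLogDeriv_eq_neg_deriv_log (u : ℝ) :
    phiNegLogDeriv u = -deriv (fun t => Real.log (deBruijnPhi t)) u := by
  rw [deriv_log_deBruijnPhi, phiNegLogDeriv, neg_div]

/-- `L′ = V`. [cite: CoffeyCsordas2013, §1 (p. 2265)] -/
theorem hasDerivAt_phiNegLogDeriv (u : ℝ) : HasDerivAt phiNegLogDeriv (phiNegLogDeriv₂ u) u := by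
  have h := ((hasDerivAt_deriv_log_deBruijnPhi u).const_mul (-1 : ℝ))
  have ef : phiNegLogDeriv = fun t => (-1 : ℝ) * (deBruijnPhiDeriv t / deBruijnPhi t) := by
    funext t; simp [phiNegLogDeriv, neg_div]
  have ev : phiNegLogDeriv₂ u =
      (-1 : ℝ) * ((deBruijnPhiDeriv₂ u * deBruijnPhi u - deBruijnPhiDeriv u * deBruijnPhiDeriv u) /
        deBruijnPhi u ^ 2) := by
    rw [phiNegLogDeriv₂]; ring
  rw [ef, ev]
  exact h

/-- `deriv L = V`. [cite: CoffeyCsordas2013, §1 (p. 2265)] -/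
theorem deriv_phiNegLogDeriv : deriv phiNegLogDeriv = phiNegLogDeriv₂ :=
  funext fun u => (hasDerivAt_phiNegLogDeriv u).deriv

/-- `L` is continuous. [cite: CoffeyCsordas2013, §1 (p. 2265)] -/
theorem continuous_phiNegLogDeriv : Continuous phiNegLogDeriv :=
  continuous_iff_continuousAt.2 fun u => (hasDerivAt_phiNegLogDeriv u).continuousAt

/-- `Φ″` is continuous (it is a finite combination of the continuous theta moments `E_{j,k}`).
[cite: CoffeyCsordas2013, (1.2)] -/
theorem continuous_deBruijnPhiDeriv₂ : Continuous deBruijnPhiDeriv₂ := by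
  have hc : ∀ j k : ℕ, Continuous fun u : ℝ => expThetaMoment j k (2 * u) :=
    fun j k => (continuous_expThetaMoment j k).comp (continuous_const.mul continuous_id)
  unfold deBruijnPhiDeriv₂
  exact (((continuous_const.mul (hc 2 2)).sub (continuous_const.mul (hc 3 3))).sub
    (continuous_const.mul (hc 1 1))).add (continuous_const.mul (hc 4 4))

/-- `V` is continuous. [cite: CoffeyCsordas2013, Theorem 2.4 ((2.17))] -/
theorem continuous_phiNegLogDeriv₂ : Continuous phiNegLogDeriv₂ := by
  unfold phiNegLogDeriv₂
  exact ((continuous_deBruijnPhiDeriv.pow 2).sub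
    (continuous_deBruijnPhi.mul continuous_deBruijnPhiDeriv₂)).div (continuous_deBruijnPhi.pow 2)
    fun u => (pow_pos (deBruijnPhi_pos_holds u) 2).ne'

/-- **Quantitative log-concavity in `V`-form: `V(u) > 16πe^{4|u|}` for every real `u`** (Coffey–Csordas
Theorem 2.4 with the constant of its proof, tree theorem `deBruijnPhi_logConcave_quantitative`).
[cite: CoffeyCsordas2013, Theorem 2.4 (proof)] -/
theorem phiNegLogDeriv₂_gt (u : ℝ) : 16 * π * Real.exp (4 * |u|) < phiNegLogDeriv₂ u := by
  rw [phiNegLogDeriv₂, lt_div_iff₀ (pow_pos (deBruijnPhi_pos_holds u) 2)]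
  exact deBruijnPhi_logConcave_quantitative u

/-- `V(u) > 16π` (in particular `V > 0`). [cite: CoffeyCsordas2013, Theorem 2.4 (proof)] -/
theorem phiNegLogDeriv₂_gt_sixteen_pi (u : ℝ) : 16 * π < phiNegLogDeriv₂ u := by
  have h := phiNegLogDeriv₂_gt u
  have h1 : 1 ≤ Real.exp (4 * |u|) := Real.one_le_exp (by positivity)
  nlinarith [Real.pi_pos]

/-- `V(u) > 0`. [cite: CoffeyCsordas2013, Theorem 2.4] -/
theorem phiNegLogDeriv₂_pos (u : ℝ) : 0 < phiNegLogDeriv₂ u :=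
  lt_trans (by positivity) (phiNegLogDeriv₂_gt_sixteen_pi u)

/-- `L` is strictly increasing on `ℝ` (`L′ = V > 0`). [cite: CoffeyCsordas2013, Theorem 2.4] -/
theorem strictMono_phiNegLogDeriv : StrictMono phiNegLogDeriv :=
  strictMono_of_deriv_pos fun u => by rw [deriv_phiNegLogDeriv]; exact phiNegLogDeriv₂_pos u

/-! ## 2. The tilted potential `W_s` and its derivatives -/

/-- The tilted potential `W_s(u) := −s·log u − log Φ(u)`; for `u > 0`, `e^{−W_s(u)} = u^s Φ(u)` is the
un-normalised density of `ν_s`. [cite: GORZPNAS2019, §4 (proof of Thm 7)] -/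
def xiPotential (s u : ℝ) : ℝ := -(s * Real.log u) - Real.log (deBruijnPhi u)

/-- `W_s′(u) = −s/u + L(u)`. [cite: GORZPNAS2019, §4 (proof of Thm 7)] -/
def xiPotentialDeriv (s u : ℝ) : ℝ := -(s / u) + phiNegLogDeriv u

/-- `W_s″(u) = s/u² + V(u)`. [cite: GORZPNAS2019, §4 (proof of Thm 7)] -/
def xiPotentialDeriv₂ (s u : ℝ) : ℝ := s / u ^ 2 + phiNegLogDeriv₂ u

/-- `e^{−W_s(u)} = u^s·Φ(u)` for `u > 0` (real power). [cite: GORZPNAS2019, §4 (proof of Thm 7)] -/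
theorem exp_neg_xiPotential {s u : ℝ} (hu : 0 < u) :
    Real.exp (-xiPotential s u) = u ^ s * deBruijnPhi u := by
  rw [xiPotential, neg_sub, sub_neg_eq_add, Real.exp_add, Real.exp_log (deBruijnPhi_pos_holds u),
    Real.rpow_def_of_pos hu, mul_comm (Real.log u) s]
  exact mul_comm _ _

/-- `e^{−W_k(u)} = u^k·Φ(u)` for `u > 0` and a natural exponent `k` (the integrand of `xiMoment k`).
[cite: GORZPNAS2019, §4 (proof of Thm 7)] -/
theorem exp_neg_xiPotential_natCast (k : ℕ) {u : ℝ} (hu : 0 < u) :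
    Real.exp (-xiPotential k u) = u ^ k * deBruijnPhi u := by
  rw [exp_neg_xiPotential hu, Real.rpow_natCast]

/-- `W_s` has derivative `W_s′` at every `u ≠ 0`. [cite: CoffeyCsordas2013, §1 (p. 2265)] -/
theorem hasDerivAt_xiPotential (s : ℝ) {u : ℝ} (hu : u ≠ 0) :
    HasDerivAt (xiPotential s) (xiPotentialDeriv s u) u := by
  have h1 : HasDerivAt (fun t => (-s) * Real.log t) ((-s) * u⁻¹) u :=
    (Real.hasDerivAt_log hu).const_mul (-s)
  have h := h1.sub (hasDerivAt_log_deBruijnPhi u)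
  have ef : xiPotential s = fun t => (-s) * Real.log t - Real.log (deBruijnPhi t) := by
    funext t; simp [xiPotential]
  have ev : xiPotentialDeriv s u = (-s) * u⁻¹ - deBruijnPhiDeriv u / deBruijnPhi u := by
    rw [xiPotentialDeriv, phiNegLogDeriv, div_eq_mul_inv s u, neg_div]; ring
  rw [ef, ev]
  exact h

/-- `W_s′` has derivative `W_s″` at every `u ≠ 0`. [cite: CoffeyCsordas2013, §1 (p. 2265)] -/
theorem hasDerivAt_xiPotentialDeriv (s : ℝ) {u : ℝ} (hu : u ≠ 0) :
    HasDerivAt (xiPotentialDeriv s) (xiPotentialDeriv₂ s u) u := by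
  have h1 : HasDerivAt (fun t : ℝ => -(s / t)) (s / u ^ 2) u := by
    have h := (hasDerivAt_inv hu).const_mul (-s)
    have ef : (fun t : ℝ => -(s / t)) = fun t => -s * t⁻¹ := by funext t; ring
    have ev : s / u ^ 2 = -s * (-(u ^ 2)⁻¹) := by ring
    rw [ef, ev]
    exact h
  have ef : xiPotentialDeriv s = fun t => -(s / t) + phiNegLogDeriv t := rfl
  rw [ef]
  exact h1.add (hasDerivAt_phiNegLogDeriv u)

/-- `deriv W_s = W_s′` on `u ≠ 0`. [cite: CoffeyCsordas2013, §1 (p. 2265)] -/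
theorem deriv_xiPotential (s : ℝ) {u : ℝ} (hu : u ≠ 0) : deriv (xiPotential s) u = xiPotentialDeriv s u :=
  (hasDerivAt_xiPotential s hu).deriv

/-- `deriv W_s′ = W_s″` on `u ≠ 0`. [cite: CoffeyCsordas2013, §1 (p. 2265)] -/
theorem deriv_xiPotentialDeriv (s : ℝ) {u : ℝ} (hu : u ≠ 0) :
    deriv (xiPotentialDeriv s) u = xiPotentialDeriv₂ s u :=
  (hasDerivAt_xiPotentialDeriv s hu).deriv

/-- `W_s″` is continuous on `{u ≠ 0}`. [cite: CoffeyCsordas2013, Theorem 2.4 ((2.17))] -/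
theorem continuousOn_xiPotentialDeriv₂ (s : ℝ) : ContinuousOn (xiPotentialDeriv₂ s) {0}ᶜ := by
  unfold xiPotentialDeriv₂
  refine ContinuousOn.add ?_ continuous_phiNegLogDeriv₂.continuousOn
  exact continuousOn_const.div (continuousOn_id.pow 2) fun u hu => pow_ne_zero 2 hu

/-- `W_s`, `W_s′` are continuous on `(0, ∞)`. [cite: CoffeyCsordas2013, §1 (p. 2265)] -/
theorem continuousOn_xiPotentialDeriv (s : ℝ) : ContinuousOn (xiPotentialDeriv s) (Ioi 0) :=
  fun _ hu => (hasDerivAt_xiPotentialDeriv s (ne_of_gt hu)).continuousAt.continuousWithinAt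

/-- `W_s` is continuous on `(0, ∞)`. [cite: CoffeyCsordas2013, §1 (p. 2265)] -/
theorem continuousOn_xiPotential (s : ℝ) : ContinuousOn (xiPotential s) (Ioi 0) :=
  fun _ hu => (hasDerivAt_xiPotential s (ne_of_gt hu)).continuousAt.continuousWithinAt

/-- **Curvature of the tilted potential: `W_s″(u) > s/u² + 16πe^{4|u|}`** (no loss term; Coffey–Csordas
Theorem 2.4 in quantitative form). [cite: CoffeyCsordas2013, Theorem 2.4 (proof)] -/
theorem xiPotentialDeriv₂_gt (s u : ℝ) : s / u ^ 2 + 16 * π * Real.exp (4 * |u|) < xiPotentialDeriv₂ s u := by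
  unfold xiPotentialDeriv₂
  linarith [phiNegLogDeriv₂_gt u]

/-- For `u > 0`: `W_s″(u) > s/u² + 16πe^{4u}`. [cite: CoffeyCsordas2013, Theorem 2.4 (proof)] -/
theorem xiPotentialDeriv₂_gt_of_pos (s : ℝ) {u : ℝ} (hu : 0 < u) :
    s / u ^ 2 + 16 * π * Real.exp (4 * u) < xiPotentialDeriv₂ s u := by
  have h := xiPotentialDeriv₂_gt s u
  rwa [abs_of_pos hu] at h

/-- `W_s″(u) > 0` for `s ≥ 0`. [cite: CoffeyCsordas2013, Theorem 2.4] -/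
theorem xiPotentialDeriv₂_pos {s : ℝ} (hs : 0 ≤ s) (u : ℝ) : 0 < xiPotentialDeriv₂ s u := by
  unfold xiPotentialDeriv₂
  have := phiNegLogDeriv₂_pos u
  positivity

/-- `W_s′` is strictly increasing on `(0, ∞)` (`s ≥ 0`). [cite: CoffeyCsordas2013, Theorem 2.4] -/
theorem strictMonoOn_xiPotentialDeriv {s : ℝ} (hs : 0 ≤ s) : StrictMonoOn (xiPotentialDeriv s) (Ioi 0) := by
  refine strictMonoOn_of_deriv_pos (convex_Ioi 0) (continuousOn_xiPotentialDeriv s) fun u hu => ?_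
  rw [interior_Ioi] at hu
  rw [deriv_xiPotentialDeriv s (ne_of_gt hu)]
  exact xiPotentialDeriv₂_pos hs u

/-- **`W_s` is strictly convex on `(0, ∞)`** (`s ≥ 0`): the laws `ν_s ∝ u^sΦ(u)du` are strictly log-concave.
[cite: CoffeyCsordas2013, Theorem 2.4] -/
theorem strictConvexOn_xiPotential {s : ℝ} (hs : 0 ≤ s) : StrictConvexOn ℝ (Ioi 0) (xiPotential s) := by
  refine strictConvexOn_of_deriv2_pos (convex_Ioi 0) (continuousOn_xiPotential s) fun u hu => ?_
  rw [interior_Ioi] at hu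
  have hu0 : u ≠ 0 := ne_of_gt hu
  have e1 : deriv (xiPotential s) =ᶠ[𝓝 u] xiPotentialDeriv s := by
    filter_upwards [isOpen_ne.mem_nhds hu0] with t ht using deriv_xiPotential s ht
  rw [show deriv^[2] (xiPotential s) u = deriv (deriv (xiPotential s)) u by rfl, e1.deriv_eq,
    deriv_xiPotentialDeriv s hu0]
  exact xiPotentialDeriv₂_pos hs u

/-- `W_s` is convex on `(0, ∞)` (`s ≥ 0`). [cite: CoffeyCsordas2013, Theorem 2.4] -/
theorem convexOn_xiPotential {s : ℝ} (hs : 0 ≤ s) : ConvexOn ℝ (Ioi 0) (xiPotential s) :=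
  (strictConvexOn_xiPotential hs).convexOn

/-! ## 3. Behaviour at `0⁺` and at `+∞` -/

/-- `W_s′(u) < 0` for all sufficiently small `u > 0` (`s > 0`): `L` is continuous with `L(0) = 0` while
`−s/u → −∞`. [cite: GORZPNAS2019, §4 (proof of Thm 7)] -/
theorem eventually_xiPotentialDeriv_neg {s : ℝ} (hs : 0 < s) :
    ∀ᶠ u in 𝓝[>] (0 : ℝ), xiPotentialDeriv s u < 0 := by
  have hL : ∀ᶠ u in 𝓝 (0 : ℝ), phiNegLogDeriv u < 1 := by
    have h := continuous_phiNegLogDeriv.tendsto 0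
    rw [phiNegLogDeriv_zero] at h
    exact h.eventually (gt_mem_nhds zero_lt_one)
  have hs' : ∀ᶠ u in 𝓝[>] (0 : ℝ), u ∈ Ioc 0 s := Ioc_mem_nhdsGT hs
  filter_upwards [mem_nhdsWithin_of_mem_nhds hL, hs'] with u h1 h2
  have h3 : 1 ≤ s / u := by rw [le_div_iff₀ h2.1]; linarith [h2.2]
  unfold xiPotentialDeriv
  linarith

/-- `W_s′(u) → +∞` as `u → +∞` (`s ≥ 0`; indeed `W_s″ ≥ 16π`). [cite: CoffeyCsordas2013, Theorem 2.4 (proof)] -/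
theorem tendsto_xiPotentialDeriv_atTop {s : ℝ} (hs : 0 ≤ s) : Tendsto (xiPotentialDeriv s) atTop atTop := by
  -- `W′(u) ≥ W′(1) + 16π(u − 1)` for `u ≥ 1`
  have hlin : ∀ u, 1 ≤ u → xiPotentialDeriv s 1 + 16 * π * (u - 1) ≤ xiPotentialDeriv s u := by
    intro u hu
    have hc : ContinuousOn (xiPotentialDeriv s) (Ici 1) :=
      (continuousOn_xiPotentialDeriv s).mono fun t ht => mem_Ioi.2 (lt_of_lt_of_le zero_lt_one (mem_Ici.1 ht))
    have hd : DifferentiableOn ℝ (xiPotentialDeriv s) (interior (Ici 1)) := by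
      rw [interior_Ici]
      exact fun t ht => (hasDerivAt_xiPotentialDeriv s
        (ne_of_gt (lt_trans zero_lt_one ht))).differentiableAt.differentiableWithinAt
    have hge : ∀ t ∈ interior (Ici (1 : ℝ)), 16 * π ≤ deriv (xiPotentialDeriv s) t := by
      rw [interior_Ici]
      intro t ht
      rw [deriv_xiPotentialDeriv s (ne_of_gt (lt_trans zero_lt_one ht))]
      have h1 := xiPotentialDeriv₂_gt s t
      have h2 : 0 ≤ s / t ^ 2 := by positivity
      have h3 : 1 ≤ Real.exp (4 * |t|) := Real.one_le_exp (by positivity)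
      nlinarith [Real.pi_pos]
    have h := (convex_Ici (1 : ℝ)).mul_sub_le_image_sub_of_le_deriv hc hd hge 1 self_mem_Ici u
      (mem_Ici.2 hu) hu
    linarith
  have hlow : Tendsto (fun u => xiPotentialDeriv s 1 + 16 * π * (u - 1)) atTop atTop := by
    have hπ : 0 < 16 * π := by positivity
    refine tendsto_atTop_add_const_left _ _ ?_
    refine Tendsto.const_mul_atTop hπ ?_
    exact tendsto_atTop_add_const_right _ _ tendsto_id
  refine tendsto_atTop_mono' atTop ?_ hlow
  filter_upwards [eventually_ge_atTop (1 : ℝ)] with u hu using hlin u hu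

/-- `W_s(u) → +∞` as `u → +∞` (`s ≥ 0`). [cite: GORZPNAS2019, §4 (proof of Thm 7)] -/
theorem tendsto_xiPotential_atTop {s : ℝ} (hs : 0 ≤ s) : Tendsto (xiPotential s) atTop atTop := by
  -- beyond some `u₁ ≥ 1`, `W′ ≥ 1`, hence `W(u) ≥ W(u₁) + (u − u₁)`
  obtain ⟨u₁, hu₁⟩ := ((tendsto_xiPotentialDeriv_atTop hs).eventually (eventually_ge_atTop 1)).and
    (eventually_ge_atTop 1) |>.exists
  have hu₁pos : 0 < u₁ := lt_of_lt_of_le zero_lt_one hu₁.2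
  have hmono := strictMonoOn_xiPotentialDeriv hs
  have hlin : ∀ u, u₁ ≤ u → xiPotential s u₁ + 1 * (u - u₁) ≤ xiPotential s u := by
    intro u hu
    have hc : ContinuousOn (xiPotential s) (Ici u₁) :=
      (continuousOn_xiPotential s).mono fun t ht => mem_Ioi.2 (lt_of_lt_of_le hu₁pos (mem_Ici.1 ht))
    have hd : DifferentiableOn ℝ (xiPotential s) (interior (Ici u₁)) := by
      rw [interior_Ici]
      exact fun t ht => (hasDerivAt_xiPotential s
        (ne_of_gt (lt_trans hu₁pos ht))).differentiableAt.differentiableWithinAt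
    have hge : ∀ t ∈ interior (Ici u₁), 1 ≤ deriv (xiPotential s) t := by
      rw [interior_Ici]
      intro t ht
      rw [deriv_xiPotential s (ne_of_gt (lt_trans hu₁pos ht))]
      exact le_trans hu₁.1 (hmono.monotoneOn (mem_Ioi.2 hu₁pos) (mem_Ioi.2 (lt_trans hu₁pos ht)) ht.le)
    have h := (convex_Ici u₁).mul_sub_le_image_sub_of_le_deriv hc hd hge u₁ self_mem_Ici u
      (mem_Ici.2 hu) hu
    linarith
  have hlow : Tendsto (fun u => xiPotential s u₁ + 1 * (u - u₁)) atTop atTop := by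
    refine tendsto_atTop_add_const_left _ _ ?_
    simp only [one_mul]
    exact tendsto_atTop_add_const_right _ _ tendsto_id
  refine tendsto_atTop_mono' atTop ?_ hlow
  filter_upwards [eventually_ge_atTop u₁] with u hu using hlin u hu

/-- `W_s(u) → +∞` as `u → 0⁺` (`s > 0`): `−s log u → +∞` and `−log Φ(u) ≥ −log Φ(0)`.
[cite: GORZPNAS2019, §4 (proof of Thm 7)] -/
theorem tendsto_xiPotential_nhdsGT_zero {s : ℝ} (hs : 0 < s) :
    Tendsto (xiPotential s) (𝓝[>] (0 : ℝ)) atTop := by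
  have ef : xiPotential s = fun u => -(s * Real.log u) + -Real.log (deBruijnPhi u) := by
    funext u; simp [xiPotential, sub_eq_add_neg]
  rw [ef]
  refine tendsto_atTop_add_right_of_le _ (-Real.log (deBruijnPhi 0)) ?_ fun u => ?_
  · exact tendsto_neg_atBot_atTop.comp (Real.tendsto_log_nhdsGT_zero.const_mul_atBot hs)
  · exact neg_le_neg (Real.log_le_log (deBruijnPhi_pos_holds u) (deBruijnPhi_le_deBruijnPhi_zero u))

/-! ## 4. The mode `a_s` -/

/-- For `s > 0`, `W_s′` has a zero on `(0, ∞)`. [cite: GORZPNAS2019, §4 (proof of Thm 7)] -/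
theorem exists_xiPotentialDeriv_eq_zero {s : ℝ} (hs : 0 < s) :
    ∃ a : ℝ, 0 < a ∧ xiPotentialDeriv s a = 0 := by
  obtain ⟨u₁, hu₁neg, hu₁pos⟩ := ((eventually_xiPotentialDeriv_neg hs).and self_mem_nhdsWithin).exists
  obtain ⟨u₂, hu₂, hu₂pos⟩ := (((tendsto_xiPotentialDeriv_atTop hs.le).eventually
    (eventually_gt_atTop 0)).and (eventually_gt_atTop 0)).exists
  have hmono := strictMonoOn_xiPotentialDeriv hs.le
  have hu₁u₂ : u₁ < u₂ := by
    by_contra h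
    have hle := hmono.monotoneOn (mem_Ioi.2 hu₂pos) (mem_Ioi.2 hu₁pos) (not_lt.1 h)
    linarith
  have hcont : ContinuousOn (xiPotentialDeriv s) (Icc u₁ u₂) :=
    (continuousOn_xiPotentialDeriv s).mono fun t ht => lt_of_lt_of_le hu₁pos ht.1
  have hmem : (0 : ℝ) ∈ Icc (xiPotentialDeriv s u₁) (xiPotentialDeriv s u₂) := ⟨hu₁neg.le, hu₂.le⟩
  obtain ⟨a, ha, ha0⟩ := intermediate_value_Icc hu₁u₂.le hcont hmem
  exact ⟨a, lt_of_lt_of_le hu₁pos ha.1, ha0⟩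

/-- **The mode** `a_s` of the law `ν_s ∝ u^sΦ(u)du` on `(0, ∞)`: for `s > 0` the (unique, see
`xiPotentialDeriv_eq_zero_iff`) critical point of the tilted potential `W_s`; junk value `0` for `s ≤ 0`
(for `s = 0` the un-normalised density `Φ` is maximal at `u = 0`). [cite: GORZPNAS2019, §4 (proof of Thm 7)] -/
def xiMode (s : ℝ) : ℝ := if hs : 0 < s then (exists_xiPotentialDeriv_eq_zero hs).choose else 0

/-- `a_s > 0` (`s > 0`). [cite: GORZPNAS2019, §4 (proof of Thm 7)] -/
theorem xiMode_pos {s : ℝ} (hs : 0 < s) : 0 < xiMode s := by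
  rw [xiMode, dif_pos hs]; exact (exists_xiPotentialDeriv_eq_zero hs).choose_spec.1

/-- `W_s′(a_s) = 0` (`s > 0`). [cite: GORZPNAS2019, §4 (proof of Thm 7)] -/
theorem xiPotentialDeriv_xiMode {s : ℝ} (hs : 0 < s) : xiPotentialDeriv s (xiMode s) = 0 := by
  rw [xiMode, dif_pos hs]; exact (exists_xiPotentialDeriv_eq_zero hs).choose_spec.2

/-- The saddle-point equation at the mode: `s = a_s · L(a_s)`, i.e. `s/a_s = −Φ′(a_s)/Φ(a_s)`.
[cite: GORZPNAS2019, §4 (proof of Thm 7)] -/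
theorem xiMode_mul_phiNegLogDeriv {s : ℝ} (hs : 0 < s) : xiMode s * phiNegLogDeriv (xiMode s) = s := by
  have h := xiPotentialDeriv_xiMode hs
  have ha := xiMode_pos hs
  unfold xiPotentialDeriv at h
  field_simp at h
  linarith

/-- **Sign of `W_s′` (mode bracket).** For `s > 0` and `u > 0`: `W_s′(u) < 0 ↔ u < a_s`.
[cite: GORZPNAS2019, §4 (proof of Thm 7)] -/
theorem xiPotentialDeriv_neg_iff {s u : ℝ} (hs : 0 < s) (hu : 0 < u) :
    xiPotentialDeriv s u < 0 ↔ u < xiMode s := by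
  rw [← xiPotentialDeriv_xiMode hs]
  exact (strictMonoOn_xiPotentialDeriv hs.le).lt_iff_lt (mem_Ioi.2 hu) (mem_Ioi.2 (xiMode_pos hs))

/-- For `s > 0` and `u > 0`: `0 < W_s′(u) ↔ a_s < u`. [cite: GORZPNAS2019, §4 (proof of Thm 7)] -/
theorem xiPotentialDeriv_pos_iff {s u : ℝ} (hs : 0 < s) (hu : 0 < u) :
    0 < xiPotentialDeriv s u ↔ xiMode s < u := by
  rw [← xiPotentialDeriv_xiMode hs]
  exact (strictMonoOn_xiPotentialDeriv hs.le).lt_iff_lt (mem_Ioi.2 (xiMode_pos hs)) (mem_Ioi.2 hu)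

/-- For `s > 0` and `u > 0`: `W_s′(u) ≤ 0 ↔ u ≤ a_s` — so a point `u₀ > 0` with `W_s′(u₀) ≤ 0`, i.e.
`u₀·L(u₀) ≤ s`, is a certified LOWER bound for the mode. [cite: GORZPNAS2019, §4 (proof of Thm 7)] -/
theorem xiPotentialDeriv_nonpos_iff {s u : ℝ} (hs : 0 < s) (hu : 0 < u) :
    xiPotentialDeriv s u ≤ 0 ↔ u ≤ xiMode s := by
  rw [← xiPotentialDeriv_xiMode hs]
  exact (strictMonoOn_xiPotentialDeriv hs.le).le_iff_le (mem_Ioi.2 hu) (mem_Ioi.2 (xiMode_pos hs))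

/-- For `s > 0` and `u > 0`: `0 ≤ W_s′(u) ↔ a_s ≤ u` (certified UPPER bounds for the mode).
[cite: GORZPNAS2019, §4 (proof of Thm 7)] -/
theorem xiPotentialDeriv_nonneg_iff {s u : ℝ} (hs : 0 < s) (hu : 0 < u) :
    0 ≤ xiPotentialDeriv s u ↔ xiMode s ≤ u := by
  rw [← xiPotentialDeriv_xiMode hs]
  exact (strictMonoOn_xiPotentialDeriv hs.le).le_iff_le (mem_Ioi.2 (xiMode_pos hs)) (mem_Ioi.2 hu)

/-- **Uniqueness of the critical point.** For `s > 0` and `u > 0`: `W_s′(u) = 0 ↔ u = a_s`.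
[cite: GORZPNAS2019, §4 (proof of Thm 7)] -/
theorem xiPotentialDeriv_eq_zero_iff {s u : ℝ} (hs : 0 < s) (hu : 0 < u) :
    xiPotentialDeriv s u = 0 ↔ u = xiMode s := by
  rw [← xiPotentialDeriv_xiMode hs]
  exact ((strictMonoOn_xiPotentialDeriv hs.le).injOn.eq_iff (mem_Ioi.2 hu) (mem_Ioi.2 (xiMode_pos hs)))

/-- The mode bracket in terms of `L`: for `s > 0`, `u > 0`, `u·L(u) ≤ s → u ≤ a_s` and `s ≤ u·L(u) → a_s ≤ u`.
[cite: GORZPNAS2019, §4 (proof of Thm 7)] -/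
theorem le_xiMode_of_mul_phiNegLogDeriv_le {s u : ℝ} (hs : 0 < s) (hu : 0 < u)
    (h : u * phiNegLogDeriv u ≤ s) : u ≤ xiMode s := by
  rw [← xiPotentialDeriv_nonpos_iff hs hu]
  unfold xiPotentialDeriv
  have : phiNegLogDeriv u ≤ s / u := by rw [le_div_iff₀ hu]; linarith
  linarith

/-- For `s > 0`, `u > 0`: `s ≤ u·L(u) → a_s ≤ u`. [cite: GORZPNAS2019, §4 (proof of Thm 7)] -/
theorem xiMode_le_of_le_mul_phiNegLogDeriv {s u : ℝ} (hs : 0 < s) (hu : 0 < u)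
    (h : s ≤ u * phiNegLogDeriv u) : xiMode s ≤ u := by
  rw [← xiPotentialDeriv_nonneg_iff hs hu]
  unfold xiPotentialDeriv
  have : s / u ≤ phiNegLogDeriv u := by rw [div_le_iff₀ hu]; linarith
  linarith

/-- **`W_s` is minimal at the mode**: `W_s(a_s) ≤ W_s(u)` for all `u > 0` (a critical point of a convex
function is a global minimiser). [cite: Peypouquet2015, Prop. 3.10 (ii)] -/
theorem xiPotential_xiMode_le {s u : ℝ} (hs : 0 < s) (hu : 0 < u) :
    xiPotential s (xiMode s) ≤ xiPotential s u := by
  have ha := xiMode_pos hs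
  have hconv := convexOn_xiPotential hs.le
  have hd : HasDerivAt (xiPotential s) 0 (xiMode s) := by
    have := hasDerivAt_xiPotential s (ne_of_gt ha)
    rwa [xiPotentialDeriv_xiMode hs] at this
  rcases lt_trichotomy u (xiMode s) with h | rfl | h
  · have h1 := hconv.slope_le_of_hasDerivAt (mem_Ioi.2 hu) (mem_Ioi.2 ha) h hd
    rw [slope_def_field] at h1
    have : xiPotential s (xiMode s) - xiPotential s u ≤ 0 := by
      have hpos : 0 < xiMode s - u := sub_pos.2 h
      have := (div_le_iff₀ hpos).1 h1
      linarith
    linarith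
  · exact le_refl _
  · have h1 := hconv.le_slope_of_hasDerivAt (mem_Ioi.2 ha) (mem_Ioi.2 hu) h hd
    rw [slope_def_field] at h1
    have hpos : 0 < u - xiMode s := sub_pos.2 h
    have := (le_div_iff₀ hpos).1 h1
    linarith

/-- `W_s` is strictly decreasing on `(0, a_s]` (`s > 0`). [cite: Peypouquet2015, Prop. 3.11] -/
theorem strictAntiOn_xiPotential {s : ℝ} (hs : 0 < s) : StrictAntiOn (xiPotential s) (Ioc 0 (xiMode s)) := by
  refine strictAntiOn_of_deriv_neg (convex_Ioc 0 _) ((continuousOn_xiPotential s).mono Ioc_subset_Ioi_self)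
    fun u hu => ?_
  rw [interior_Ioc] at hu
  rw [deriv_xiPotential s (ne_of_gt hu.1)]
  exact (xiPotentialDeriv_neg_iff hs hu.1).2 hu.2

/-- `W_s` is strictly increasing on `[a_s, ∞)` (`s > 0`). [cite: Peypouquet2015, Prop. 3.11] -/
theorem strictMonoOn_xiPotential {s : ℝ} (hs : 0 < s) : StrictMonoOn (xiPotential s) (Ici (xiMode s)) := by
  have ha := xiMode_pos hs
  refine strictMonoOn_of_deriv_pos (convex_Ici _)
    ((continuousOn_xiPotential s).mono fun t ht => lt_of_lt_of_le ha ht) fun u hu => ?_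
  rw [interior_Ici] at hu
  have hu0 : 0 < u := lt_trans ha hu
  rw [deriv_xiPotential s (ne_of_gt hu0)]
  exact (xiPotentialDeriv_pos_iff hs hu0).2 hu

/-- **The mode increases with the tilt**: `0 < s < t → a_s < a_t` (`W_t′(a_s) = −(t − s)/a_s < 0`).
[cite: GORZPNAS2019, §4 (proof of Thm 7)] -/
theorem xiMode_strictMonoOn : StrictMonoOn xiMode (Ioi 0) := by
  intro s hs t ht hst
  have has := xiMode_pos hs
  rw [← xiPotentialDeriv_neg_iff ht has]
  have h0 := xiPotentialDeriv_xiMode hs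
  unfold xiPotentialDeriv at h0 ⊢
  have : s / xiMode s < t / xiMode s := div_lt_div_of_pos_right hst has
  linarith

end Literature.NumberTheory.LFunctions

end
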